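import Summits.AtomisticToContinuum.Crystallization.Theorems.FrustratedLawDichotomyStrainedPatchHomEntryLeafHTA2QCellB910S1

/-!
# THE `0.9 t_b` PRODUCTION CELL `cT090 × wB910`, part 2: ★★★ the certificate side `htCertSideA2Q pB910A2 QB910 GnB910 JT090 cT090 wB910 = true`
# (27623 `(H) HomFloor (1/625)`, hcp half; hand-1 g36; critic row 1360 (4))

decomp-a2c hand-1 g36.  KERNEL: `restB910A2` (`htCertRestA2`: ball / jac / straddlers / PSD confinement / curvature floor `λ₁ = 0.92` / far Jacobians / guards),
`linB910A2` (`354882107889 ≤ 356000000000`), `farB910A2` (`396115603476 ≤ 398888000000`); with `…CellB910S1.qB910_0/1/2`: ★★★ `htCertSideA2Q_B910A2`.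

Kernel facts + assembly; 0 sorry; standard axioms; no definitions.  `--supports stmt-AtomisticToContinuum-27623`.
-/

namespace Summit.AtomisticToContinuum.Crystallization.Theorems.FrustratedLawDichotomyStrainedPatchHomEntryLeafHT

open Literature.Analysis.ValidatedNumerics.Numerics
open Summit.AtomisticToContinuum.Crystallization.Theorems.FrustratedLawDichotomyStrainedPatchHomCertTree (CertTree treeOK)
open Summit.AtomisticToContinuum.Crystallization.Theorems.FrustratedLawDichotomyStrainedPatchHomEntryTable (muRec)
open Summit.AtomisticToContinuum.Crystallization.Theorems.FrustratedLawDichotomyStrainedPatchHomEntryFitTolerance (cT090)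
open Summit.AtomisticToContinuum.Crystallization.Theorems.FrustratedLawDichotomyStrainedPatchHomSlopeLJ
open Summit.AtomisticToContinuum.Crystallization.Theorems.FrustratedLawDichotomyStrainedPatchHomSlopeLJAffine
open Summit.AtomisticToContinuum.Crystallization.Theorems.FrustratedLawDichotomyStrainedPatchHomSlopeLJAffine2Kit

set_option maxRecDepth 100000 in
set_option maxHeartbeats 4000000 in
/-- ★ KERNEL: the non-slope conjuncts of the certificate side at `cT090 × wB910`. -/
theorem restB910A2 : htCertRestA2 pB910A2 JT090 cT090 wB910 = true := by
  decide +kernel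

set_option maxRecDepth 100000 in
set_option maxHeartbeats 4000000 in
/-- ★ KERNEL: `g₀ + lin + ⌈√ΣQ²⌉ + rem3 + nai = 354882107889 ≤ GnB910`. -/
theorem linB910A2 : g0LJ cT090 (htScA2F cT090 wB910 JT090 (htNearU cT090 wB910)) + linLJA cT090 wB910 JT090 (htScA2F cT090 wB910 JT090 (htNearU cT090 wB910)) + sqrtQ QB910 +
    rem3LJ cT090 (hullW JT090 wB910) (htScA2F cT090 wB910 JT090 (htNearU cT090 wB910)) + naiSLJ cT090 (hullW JT090 wB910) (htSnA2F cT090 wB910 JT090 (htNearU cT090 wB910)) ≤ GnB910 := by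
  decide +kernel

set_option maxRecDepth 100000 in
set_option maxHeartbeats 4000000 in
/-- KERNEL: `GnB910 + far₁ + far₂ = 396115603476 ≤ Gs`. -/
theorem farB910A2 : GnB910 + htGsNA cT090 wB910 JT090 (htFar1U cT090 wB910) + htGsNA cT090 wB910 JT090 (htFar2U cT090 wB910) ≤ pB910A2.Gs := by
  decide +kernel

/-- ★★★ **THE SECOND-ORDER AFFINE CERTIFICATE SIDE OF THE `0.9 t_b` CELL HOLDS** (six kernel facts; slack `0.7 %` of `Gs`). [assembly] -/
theorem htCertSideA2Q_B910A2 : htCertSideA2Q pB910A2 QB910 GnB910 JT090 cT090 wB910 = true :=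
  htCertSideA2Q_of_parts restB910A2 qB910_0 qB910_1 qB910_2 linB910A2 farB910A2

end Summit.AtomisticToContinuum.Crystallization.Theorems.FrustratedLawDichotomyStrainedPatchHomEntryLeafHT
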